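import Literature.NumberTheory.Congruences.DworkCongruencesGhostTerms
import Literature.Combinatorics.Enumerative.AperyNumbersZetaTwo
import HarnessLib

/-!
# Dwork congruences for Apéry's `ζ(2)` numbers (Mellit–Vlasenko's example)

Topic `Literature/Combinatorics/Enumerative`, namespace `Literature.Combinatorics.Enumerative.AperyDworkCongruences`
(companion of `AperyLucasCongruences.lean`; consumer of `Literature/NumberTheory/Congruences/DworkCongruences*.lean`).

Source, read on the page: A. Mellit, M. Vlasenko, *Dwork's congruences for the constant terms of powers of a
Laurent polynomial*, Int. J. Number Theory **12** (2016) 313–321 = arXiv:1306.5811, §1 [MellitVlasenko2016]: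
"Let us take for example the Laurent polynomial `Λ(x_1, x_2) = (1 + x_1)(1 + x_2)(1 + x_1 + x_2)/(x_1 x_2)`. One can
show that the sequence of the constant terms of its powers is the Apéry sequence `b_n = Σ_{k=0}^{n} C(n,k)² C(n+k,k)`.
Conditions of Theorem 1 are satisfied for all primes `p` since coefficients are integral and the Newton polygon of
`Λ` has one interior integral point." With [MellitVlasenko2016, §1 (dig2)] (= [SamolVanstraten2015, Thm. 6], the
tree's `samolVanStraten2015_theorem6_holds` / `dwork_congruence`) this gives the Dwork congruences
`b_{n+mp^s} b_{⌊n/p⌋} ≡ b_n b_{⌊n/p⌋+mp^{s−1}} (mod p^s)` for Apéry's `ζ(2)` numbers `B_n = 1, 3, 19, 147, 1251, …`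
(the tree's `AperyNumbersZetaTwo.apery2Number`).

Everything in this file is PROVED (no named fact):

* `mvLaurent` — the Laurent polynomial `Λ = (1 + x_1)(1 + x_2)(1 + x_1 + x_2) · x_1^{−1} x_2^{−1} ∈ ℤ[x_1^{±1}, x_2^{±1}]`,
  built from the bivariate polynomial `numer = (1+X)(1+Y)(1+X+Y) ∈ ℤ[X][Y]` through the substitution
  `toLaurent : X ↦ x_1, Y ↦ x_2` (`coeff_toLaurent`: coefficients are transported faithfully);
* **`ctPow_mvLaurent`** — "the sequence of the constant terms of its powers is the Apéry sequence":
  `[Λ^n]_0 = B_n`, via `[x_1^n x_2^n] (1+X)^n (1+Y)^n (1+X+Y)^n = Σ_k C(n,k) C(n,n−k) C(n+k,n)` (expand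
  `(1+Y)^n (Y + (1+X))^n` in `Y`, then `(1+X)^{n+k}` in `X`);
* **`originUnique_mvLaurent`** — "the Newton polygon of `Λ` has one interior integral point": the typed hypothesis
  `OriginUniqueInteriorLatticePoint Λ` HOLDS (so it is not vacuous): `0` is interior because the open square
  `|x| + |y| < 1` lies in the hull of the exponents `(±1, 0), (0, ±1)`; no other lattice point is interior because
  every exponent `(i−1, j−1)` of `Λ` satisfies `x ≥ −1, y ≥ −1, x + y ≤ 1`, and a lattice point of that triangle other
  than `0` lies on its boundary;
* **`apery2Number_dwork_congruence`** — for every prime `p`, `s ≥ 1` and `n, m ≥ 0`: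
  `p^s ∣ B_{n+mp^s} B_{⌊n/p⌋} − B_n B_{⌊n/p⌋+mp^{s−1}}` (in `ℤ`).
-/

noncomputable section

open Finset Polynomial Pointwise

namespace Literature.Combinatorics.Enumerative.AperyDworkCongruences

open Literature.NumberTheory.Congruences.DworkCongruences
open Literature.Combinatorics.Enumerative.AperyNumbersZetaTwo (apery2Number apery2Term)

/-! ## The Laurent polynomial `Λ = (1 + x_1)(1 + x_2)(1 + x_1 + x_2)/(x_1 x_2)` -/

/-- The exponent vector `(a, b) ∈ ℤ²`. [cite: MellitVlasenko2016, §1 (example `Λ(x_1, x_2)`)] -/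
def expVec (a b : ℤ) : Fin 2 → ℤ := ![a, b]

/-- First coordinate of `expVec`. [cite: MellitVlasenko2016, §1 (example)] -/
@[simp] theorem expVec_zero (a b : ℤ) : expVec a b 0 = a := rfl

/-- Second coordinate of `expVec`. [cite: MellitVlasenko2016, §1 (example)] -/
@[simp] theorem expVec_one (a b : ℤ) : expVec a b 1 = b := rfl

/-- `expVec` is additive. [cite: MellitVlasenko2016, §1 (example)] -/
theorem expVec_add (a b c e : ℤ) : expVec a b + expVec c e = expVec (a + c) (b + e) := by
  ext k; fin_cases k <;> simp

/-- `n • (a, b) = (na, nb)`. [cite: MellitVlasenko2016, §1 (example)] -/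
theorem nsmul_expVec (n : ℕ) (a b : ℤ) : n • expVec a b = expVec (n * a) (n * b) := by
  ext k; fin_cases k <;> simp

/-- `expVec` is injective. [cite: MellitVlasenko2016, §1 (example)] -/
theorem expVec_inj {a b c e : ℤ} (h : expVec a b = expVec c e) : a = c ∧ b = e :=
  ⟨by simpa using congrFun h 0, by simpa using congrFun h 1⟩

/-- The monomial `x_1`. [cite: MellitVlasenko2016, §1 (example)] -/
def X1 : LaurentPoly ℤ 2 := AddMonoidAlgebra.single (expVec 1 0) 1

/-- The monomial `x_2`. [cite: MellitVlasenko2016, §1 (example)] -/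
def X2 : LaurentPoly ℤ 2 := AddMonoidAlgebra.single (expVec 0 1) 1

/-- The substitution `ℤ[X][Y] → ℤ[x_1^{±1}, x_2^{±1}]`, `X ↦ x_1`, `Y ↦ x_2`. [cite: MellitVlasenko2016, §1
(example)] -/
def toLaurent : ℤ[X][X] →+* LaurentPoly ℤ 2 :=
  Polynomial.eval₂RingHom (Polynomial.eval₂RingHom (Int.castRingHom (LaurentPoly ℤ 2)) X1) X2

/-- `q = 1 + X`. [cite: MellitVlasenko2016, §1 (example, the factor `1 + x_1`)] -/
def q : ℤ[X] := 1 + X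

/-- The numerator `(1+X)(1+Y)(1+X+Y) = (1+X)² + ((1+X) + (1+X)²) Y + (1+X) Y²` of `Λ`, as a polynomial in `Y`
over `ℤ[X]`. [cite: MellitVlasenko2016, §1 (example)] -/
def numer : ℤ[X][X] := C (q ^ 2) + C (q + q ^ 2) * X + C q * X ^ 2

/-- The factored form `numer = (1+X) · (1+Y) · (Y + (1+X))`. [cite: MellitVlasenko2016, §1 (example)] -/
theorem numer_eq : numer = C q * ((1 + X) * (X + C q)) := by
  simp only [numer, map_add, map_pow]
  ring

/-- `q_i = C(1, i)`. [cite: MellitVlasenko2016, §1 (example)] -/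
theorem q_coeff (i : ℕ) : q.coeff i = ((1 : ℕ).choose i : ℤ) := by
  rw [q, show (1 + X : ℤ[X]) = (1 + X) ^ 1 from (pow_one _).symm, coeff_one_add_X_pow]

/-- `(q²)_i = C(2, i)`. [cite: MellitVlasenko2016, §1 (example)] -/
theorem q_sq_coeff (i : ℕ) : (q ^ 2).coeff i = ((2 : ℕ).choose i : ℤ) := by
  rw [q, coeff_one_add_X_pow]

/-- `[Y^0] numer = (1+X)²`. [cite: MellitVlasenko2016, §1 (example)] -/
theorem numer_coeff_zero : numer.coeff 0 = q ^ 2 := by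
  simp only [numer, coeff_add, coeff_C, coeff_C_mul_X, coeff_C_mul_X_pow]; simp

/-- `[Y^1] numer = (1+X) + (1+X)²`. [cite: MellitVlasenko2016, §1 (example)] -/
theorem numer_coeff_one : numer.coeff 1 = q + q ^ 2 := by
  simp only [numer, coeff_add, coeff_C, coeff_C_mul_X, coeff_C_mul_X_pow]; simp

/-- `[Y^2] numer = 1+X`. [cite: MellitVlasenko2016, §1 (example)] -/
theorem numer_coeff_two : numer.coeff 2 = q := by
  simp only [numer, coeff_add, coeff_C, coeff_C_mul_X, coeff_C_mul_X_pow]; simp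

/-- `[Y^j] numer = 0` for `j ≥ 3`. [cite: MellitVlasenko2016, §1 (example)] -/
theorem numer_coeff_ge {j : ℕ} (hj : 3 ≤ j) : numer.coeff j = 0 := by
  have h0 : j ≠ 0 := by omega
  have h1 : j ≠ 1 := by omega
  have h2 : j ≠ 2 := by omega
  simp only [numer, coeff_add, coeff_C, coeff_C_mul_X, coeff_C_mul_X_pow, h0, h1, h2, if_false, add_zero]

/-- Mellit–Vlasenko's example `Λ(x_1, x_2) = (1 + x_1)(1 + x_2)(1 + x_1 + x_2)/(x_1 x_2)`.
[cite: MellitVlasenko2016, §1 (example)] -/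
def mvLaurent : LaurentPoly ℤ 2 := toLaurent numer * AddMonoidAlgebra.single (expVec (-1) (-1)) 1

/-! ## Transport of coefficients along `toLaurent` -/

/-- `toLaurent (C f · Y^j) = Σ_i f_i · x_1^i x_2^j`. [cite: MellitVlasenko2016, §1 (example)] -/
theorem toLaurent_C_mul_X_pow (f : ℤ[X]) (j : ℕ) :
    toLaurent (C f * X ^ j) =
      ∑ i ∈ f.support, AddMonoidAlgebra.single (expVec i j) (f.coeff i) := by
  unfold toLaurent
  rw [map_mul, map_pow, Polynomial.coe_eval₂RingHom, eval₂_C, eval₂_X, Polynomial.coe_eval₂RingHom,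
    eval₂_eq_sum, Polynomial.sum_def, Finset.sum_mul]
  refine Finset.sum_congr rfl fun i _ => ?_
  rw [eq_intCast, AddMonoidAlgebra.intCast_def, X1, X2, AddMonoidAlgebra.single_pow, AddMonoidAlgebra.single_pow,
    AddMonoidAlgebra.single_mul_single, AddMonoidAlgebra.single_mul_single, one_pow, one_pow, mul_one, mul_one,
    zero_add, nsmul_expVec, nsmul_expVec, expVec_add]
  simp

/-- `toLaurent Q = Σ_{i,j} Q_{i,j} x_1^i x_2^j`. [cite: MellitVlasenko2016, §1 (example)] -/
theorem toLaurent_eq_sum (Q : ℤ[X][X]) :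
    toLaurent Q = ∑ j ∈ Q.support, ∑ i ∈ (Q.coeff j).support,
      AddMonoidAlgebra.single (expVec i j) ((Q.coeff j).coeff i) := by
  conv_lhs => rw [Q.as_sum_support_C_mul_X_pow]
  rw [map_sum]
  exact Finset.sum_congr rfl fun j _ => toLaurent_C_mul_X_pow _ _

/-- Coefficients are transported faithfully: `[x_1^i x_2^j] toLaurent Q = Q_{i,j}`.
[cite: MellitVlasenko2016, §1 (example)] -/
theorem coeff_toLaurent (Q : ℤ[X][X]) (i j : ℕ) :
    (toLaurent Q).coeff (expVec i j) = (Q.coeff j).coeff i := by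
  rw [toLaurent_eq_sum, AddMonoidAlgebra.coeff_sum, Finsupp.finsetSum_apply]
  rw [Finset.sum_eq_single j]
  · rw [AddMonoidAlgebra.coeff_sum, Finsupp.finsetSum_apply, Finset.sum_eq_single i]
    · rw [AddMonoidAlgebra.coeff_single, Finsupp.single_eq_same]
    · intro i' _ hi'
      rw [AddMonoidAlgebra.coeff_single, Finsupp.single_eq_of_ne]
      exact fun h => hi' (by exact_mod_cast (expVec_inj h).1.symm)
    · intro hi
      rw [AddMonoidAlgebra.coeff_single, Finsupp.single_eq_same]
      exact Polynomial.notMem_support_iff.1 hi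
  · intro j' _ hj'
    rw [AddMonoidAlgebra.coeff_sum, Finsupp.finsetSum_apply]
    refine Finset.sum_eq_zero fun i' _ => ?_
    rw [AddMonoidAlgebra.coeff_single, Finsupp.single_eq_of_ne]
    exact fun h => hj' (by exact_mod_cast (expVec_inj h).2.symm)
  · intro hj
    rw [Polynomial.notMem_support_iff.1 hj]
    simp

/-- The support of `toLaurent Q` consists of the `(i, j)` with `Q_{i,j} ≠ 0`.
[cite: MellitVlasenko2016, §1 (example)] -/
theorem exists_of_coeff_toLaurent_ne_zero (Q : ℤ[X][X]) {w : Fin 2 → ℤ} (hw : (toLaurent Q).coeff w ≠ 0) :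
    ∃ i j : ℕ, (Q.coeff j).coeff i ≠ 0 ∧ w = expVec i j := by
  rw [toLaurent_eq_sum, AddMonoidAlgebra.coeff_sum, Finsupp.finsetSum_apply] at hw
  obtain ⟨j, _, hj⟩ := Finset.exists_ne_zero_of_sum_ne_zero hw
  rw [AddMonoidAlgebra.coeff_sum, Finsupp.finsetSum_apply] at hj
  obtain ⟨i, _, hi⟩ := Finset.exists_ne_zero_of_sum_ne_zero hj
  rw [AddMonoidAlgebra.coeff_single] at hi
  obtain ⟨h1, h2⟩ := Finsupp.single_apply_ne_zero.1 hi
  exact ⟨i, j, h2, h1⟩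

/-! ## `[Λ^n]_0 = B_n` -/

/-- `[x_1^n x_2^n] ((1+X)(1+Y)(1+X+Y))^n = Σ_k C(n,k)² C(n+k,k) = B_n`.
[cite: MellitVlasenko2016, §1 (example: "the constant terms of its powers is the Apéry sequence")] -/
theorem coeff_numer_pow (n : ℕ) : ((numer ^ n).coeff n).coeff n = (apery2Number n : ℤ) := by
  rw [numer_eq, mul_pow, ← map_pow, coeff_C_mul, mul_pow, coeff_mul ((1 + X : ℤ[X][X]) ^ n) ((X + C q) ^ n) n,
    Finset.Nat.sum_antidiagonal_eq_sum_range_succ_mk, Finset.mul_sum, finsetSum_coeff]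
  rw [apery2Number, Nat.cast_sum]
  refine Finset.sum_congr rfl fun k hk => ?_
  rw [Finset.mem_range, Nat.lt_succ_iff] at hk
  simp only
  rw [coeff_one_add_X_pow, coeff_X_add_C_pow, Nat.sub_sub_self hk, Nat.choose_symm hk, ← C_eq_natCast,
    show q ^ n * (C (n.choose k : ℤ) * (q ^ k * C (n.choose k : ℤ))) =
      C ((n.choose k : ℤ) * (n.choose k)) * q ^ (n + k) by rw [map_mul, pow_add]; ring,
    coeff_C_mul, q, coeff_one_add_X_pow, show (n + k).choose n = (n + k).choose k by
      rw [← Nat.choose_symm (Nat.le_add_right n k), Nat.add_sub_cancel_left], apery2Term]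
  push_cast
  ring

/-- **"The sequence of the constant terms of its powers is the Apéry sequence":** `[Λ^n]_0 = B_n`.
[cite: MellitVlasenko2016, §1 (example)] -/
theorem ctPow_mvLaurent (n : ℕ) : ctPow mvLaurent n = (apery2Number n : ℤ) := by
  unfold ctPow constTerm mvLaurent
  rw [mul_pow, ← map_pow, AddMonoidAlgebra.single_pow, one_pow, AddMonoidAlgebra.coeff_mul_single_apply, mul_one,
    nsmul_expVec, zero_add, show -expVec (n * -1) (n * -1) = expVec (n : ℕ) (n : ℕ) by
      ext k; fin_cases k <;> simp,
    coeff_toLaurent, coeff_numer_pow]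

/-! ## The Newton polygon: `0` is its only interior lattice point -/

/-- The coefficients of the numerator vanish outside the triangle `i + j ≤ 3`.
[cite: MellitVlasenko2016, §1 (example: "the Newton polygon of `Λ`")] -/
theorem coeff_numer_eq_zero {i j : ℕ} (h : 3 < i + j) : (numer.coeff j).coeff i = 0 := by
  rcases Nat.lt_or_ge j 3 with hj | hj
  · interval_cases j
    · rw [numer_coeff_zero, q_sq_coeff, Nat.choose_eq_zero_of_lt (by omega), Nat.cast_zero]
    · rw [numer_coeff_one, coeff_add, q_coeff, q_sq_coeff, Nat.choose_eq_zero_of_lt (by omega),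
        Nat.choose_eq_zero_of_lt (by omega), Nat.cast_zero, add_zero]
    · rw [numer_coeff_two, q_coeff, Nat.choose_eq_zero_of_lt (by omega), Nat.cast_zero]
  · rw [numer_coeff_ge hj, coeff_zero]

/-- Every exponent of `Λ` is `(i − 1, j − 1)` with `Q_{i,j} ≠ 0`, hence with `i + j ≤ 3`.
[cite: MellitVlasenko2016, §1 (example: "the Newton polygon of `Λ`")] -/
theorem mem_support_mvLaurent {v : Fin 2 → ℤ} (hv : v ∈ mvLaurent.coeff.support) :
    ∃ i j : ℕ, i + j ≤ 3 ∧ v = expVec ((i : ℤ) - 1) ((j : ℤ) - 1) := by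
  rw [Finsupp.mem_support_iff, mvLaurent, AddMonoidAlgebra.coeff_mul_single_apply, mul_one] at hv
  obtain ⟨i, j, hij, hw⟩ := exists_of_coeff_toLaurent_ne_zero numer hv
  refine ⟨i, j, ?_, ?_⟩
  · by_contra h
    exact hij (coeff_numer_eq_zero (by omega))
  · have : v = expVec i j + expVec (-1) (-1) := by rw [← hw, neg_add_cancel_right]
    rw [this, expVec_add]
    simp [sub_eq_add_neg]

/-- The evaluation of the lattice embedding. [cite: SamolVanstraten2015, §2 (`supp(f) ⊂ ℤ^n ⊂ ℝ^n`)] -/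
@[simp] theorem latticeEmb_apply {d : ℕ} (u : Fin d → ℤ) (k : Fin d) : latticeEmb d u k = (u k : ℝ) := rfl

/-- The Newton polygon of `Λ` lies in the triangle `x ≥ −1, y ≥ −1, x + y ≤ 1`.
[cite: MellitVlasenko2016, §1 (example: "the Newton polygon of `Λ`")] -/
theorem newtonPolytope_subset_triangle :
    newtonPolytope mvLaurent ⊆ {x : Fin 2 → ℝ | -1 ≤ x 0 ∧ -1 ≤ x 1 ∧ x 0 + x 1 ≤ 1} := by
  refine convexHull_min ?_ ?_
  · rintro _ ⟨v, hv, rfl⟩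
    obtain ⟨i, j, hij, rfl⟩ := mem_support_mvLaurent hv
    simp only [Set.mem_setOf_eq, latticeEmb_apply, expVec_zero, expVec_one]
    push_cast
    refine ⟨by linarith [(Nat.cast_nonneg i : (0 : ℝ) ≤ i)], by linarith [(Nat.cast_nonneg j : (0 : ℝ) ≤ j)], ?_⟩
    have : ((i : ℝ)) + j ≤ 3 := by exact_mod_cast hij
    linarith
  · have h0 : IsLinearMap ℝ (fun x : Fin 2 → ℝ => x 0) := ⟨fun x y => rfl, fun c x => rfl⟩
    have h1 : IsLinearMap ℝ (fun x : Fin 2 → ℝ => x 1) := ⟨fun x y => rfl, fun c x => rfl⟩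
    have h01 : IsLinearMap ℝ (fun x : Fin 2 → ℝ => x 0 + x 1) :=
      ⟨fun x y => by simp only [Pi.add_apply]; ring, fun c x => by simp only [Pi.smul_apply, smul_eq_mul]; ring⟩
    have := ((convex_halfSpace_ge h0 (-1)).inter (convex_halfSpace_ge h1 (-1))).inter (convex_halfSpace_le h01 1)
    convert this using 1
    ext x; simp [and_assoc]

/-- Specific coefficients of `Λ`: the exponents `(1,0), (−1,0), (0,1), (0,−1)` occur (with coefficients
`1, 2, 1, 2`). [cite: MellitVlasenko2016, §1 (example)] -/
theorem coeff_mvLaurent_eq (a b : ℤ) (i j : ℕ) (ha : a + 1 = i) (hb : b + 1 = j) :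
    mvLaurent.coeff (expVec a b) = (numer.coeff j).coeff i := by
  rw [mvLaurent, AddMonoidAlgebra.coeff_mul_single_apply, mul_one,
    show expVec a b + -expVec (-1) (-1) = expVec (i : ℤ) (j : ℤ) by
      rw [← ha, ← hb]; ext k; fin_cases k <;> simp,
    coeff_toLaurent]

/-- The four unit exponents `(±1, 0), (0, ±1)` lie in the support of `Λ`.
[cite: MellitVlasenko2016, §1 (example)] -/
theorem unit_mem_support :
    expVec 1 0 ∈ mvLaurent.coeff.support ∧ expVec (-1) 0 ∈ mvLaurent.coeff.support ∧
      expVec 0 1 ∈ mvLaurent.coeff.support ∧ expVec 0 (-1) ∈ mvLaurent.coeff.support := by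
  have c10 : Nat.choose 1 0 = 1 := by decide
  have c11 : Nat.choose 1 1 = 1 := by decide
  have c12 : Nat.choose 1 2 = 0 := by decide
  have c20 : Nat.choose 2 0 = 1 := by decide
  have c21 : Nat.choose 2 1 = 2 := by decide
  have c22 : Nat.choose 2 2 = 1 := by decide
  simp only [Finsupp.mem_support_iff]
  refine ⟨?_, ?_, ?_, ?_⟩
  · rw [coeff_mvLaurent_eq 1 0 2 1 (by norm_num) (by norm_num), numer_coeff_one, coeff_add, q_coeff, q_sq_coeff,
      c12, c22]; norm_num
  · rw [coeff_mvLaurent_eq (-1) 0 0 1 (by norm_num) (by norm_num), numer_coeff_one, coeff_add, q_coeff, q_sq_coeff,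
      c10, c20]; norm_num
  · rw [coeff_mvLaurent_eq 0 1 1 2 (by norm_num) (by norm_num), numer_coeff_two, q_coeff, c11]; norm_num
  · rw [coeff_mvLaurent_eq 0 (-1) 1 0 (by norm_num) (by norm_num), numer_coeff_zero, q_sq_coeff, c21]; norm_num

/-- The open square `|x| + |y| < 1` lies in the Newton polygon (it is in the hull of `(±1,0), (0,±1)`).
[cite: MellitVlasenko2016, §1 (example: "the Newton polygon of `Λ` has one interior integral point")] -/
theorem square_subset_newtonPolytope :
    {x : Fin 2 → ℝ | |x 0| + |x 1| < 1} ⊆ newtonPolytope mvLaurent := by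
  intro x hx
  rw [Set.mem_setOf_eq] at hx
  obtain ⟨hP1, hP2, hP3, hP4⟩ := unit_mem_support
  have hS : ∀ v ∈ mvLaurent.coeff.support, latticeEmb 2 v ∈ newtonPolytope mvLaurent :=
    fun v hv => subset_convexHull ℝ _ ⟨v, hv, rfl⟩
  set a := x 0
  set b := x 1
  set r := 1 - |a| - |b| with hr
  have hr0 : 0 < r := by linarith
  -- weights on `(1,0), (−1,0), (0,1), (0,−1)`
  let w : Fin 4 → ℝ := ![max a 0 + r / 2, max (-a) 0 + r / 2, max b 0, max (-b) 0]
  let z : Fin 4 → (Fin 2 → ℝ) :=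
    ![latticeEmb 2 (expVec 1 0), latticeEmb 2 (expVec (-1) 0), latticeEmb 2 (expVec 0 1),
      latticeEmb 2 (expVec 0 (-1))]
  have hw0 : ∀ i ∈ (Finset.univ : Finset (Fin 4)), 0 ≤ w i := by
    intro i _
    fin_cases i <;> simp [w] <;> positivity
  have hw1 : ∑ i, w i = 1 := by
    rw [Fin.sum_univ_four]
    simp only [w, Matrix.cons_val_zero, Matrix.cons_val_one, Matrix.cons_val_two, Matrix.cons_val_three,
      Matrix.head_cons, Matrix.tail_cons]
    have h1 := max_zero_add_max_neg_zero_eq_abs_self a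
    have h2 := max_zero_add_max_neg_zero_eq_abs_self b
    linarith
  have hz : ∀ i ∈ (Finset.univ : Finset (Fin 4)), z i ∈ newtonPolytope mvLaurent := by
    intro i _
    fin_cases i
    · exact hS _ hP1
    · exact hS _ hP2
    · exact hS _ hP3
    · exact hS _ hP4
  have hsum : ∑ i, w i • z i = x := by
    rw [Fin.sum_univ_four]
    have h1 := max_zero_sub_max_neg_zero_eq_self a
    have h2 := max_zero_sub_max_neg_zero_eq_self b
    ext k
    fin_cases k
    · simp [w, z]
      linarith
    · simp [w, z]
      linarith
  have := (convex_convexHull ℝ _).sum_mem hw0 hw1 hz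
  rwa [hsum] at this

/-- **"The Newton polygon of `Λ` has one interior integral point":** the hypothesis
`OriginUniqueInteriorLatticePoint` of the Dwork-congruence theorems holds for `Λ` (in particular it is not
vacuous). [cite: MellitVlasenko2016, §1 (example)] -/
theorem originUnique_mvLaurent : OriginUniqueInteriorLatticePoint mvLaurent := by
  constructor
  · -- `0` is interior: the open square around it lies in the polygon
    have hopen : IsOpen {x : Fin 2 → ℝ | |x 0| + |x 1| < 1} :=
      isOpen_lt (((continuous_apply 0).abs).add ((continuous_apply 1).abs)) continuous_const
    apply interior_mono square_subset_newtonPolytope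
    rw [hopen.interior_eq]
    simp
  · -- any interior lattice point is `0`
    intro u hu
    rw [mem_interior_iff_mem_nhds, Metric.mem_nhds_iff] at hu
    obtain ⟨ε, hε, hball⟩ := hu
    have hT : ∀ y ∈ Metric.ball (latticeEmb 2 u) ε,
        y ∈ {x : Fin 2 → ℝ | -1 ≤ x 0 ∧ -1 ≤ x 1 ∧ x 0 + x 1 ≤ 1} :=
      fun y hy => newtonPolytope_subset_triangle (hball hy)
    -- test points `u − (ε/2, 0)`, `u − (0, ε/2)`, `u + (ε/2, ε/2)`
    have hmem : ∀ (δ0 δ1 : ℝ), |δ0| < ε → |δ1| < ε →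
        (fun k : Fin 2 => (u k : ℝ) + (![δ0, δ1] : Fin 2 → ℝ) k) ∈ Metric.ball (latticeEmb 2 u) ε := by
      intro δ0 δ1 h0 h1
      rw [Metric.mem_ball, dist_pi_lt_iff hε]
      intro k
      fin_cases k
      · simpa [Real.dist_eq] using h0
      · simpa [Real.dist_eq] using h1
    have hε2 : |ε / 2| < ε := by rw [abs_of_pos (by positivity)]; linarith
    have hε2' : |-(ε / 2)| < ε := by rw [abs_neg]; exact hε2
    have t1 := hT _ (hmem (-(ε / 2)) 0 hε2' (by simpa using hε))
    have t2 := hT _ (hmem 0 (-(ε / 2)) (by simpa using hε) hε2')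
    have t3 := hT _ (hmem (ε / 2) (ε / 2) hε2 hε2)
    simp only [Set.mem_setOf_eq, Matrix.cons_val_zero, Matrix.cons_val_one] at t1 t2 t3
    have hu0 : (-1 : ℝ) < u 0 := by linarith [t1.1]
    have hu1 : (-1 : ℝ) < u 1 := by linarith [t2.2.1]
    have hu01 : (u 0 : ℝ) + u 1 < 1 := by linarith [t3.2.2]
    have i0 : (-1 : ℤ) < u 0 := by exact_mod_cast hu0
    have i1 : (-1 : ℤ) < u 1 := by exact_mod_cast hu1
    have i01 : u 0 + u 1 < 1 := by exact_mod_cast hu01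
    ext k
    fin_cases k
    · show u 0 = 0; omega
    · show u 1 = 0; omega

/-- **Dwork congruences for Apéry's `ζ(2)` numbers** `B_n = Σ_k C(n,k)² C(n+k,k)`: for every prime `p`, `s ≥ 1`,
`n, m ≥ 0`, `p^s ∣ B_{n+mp^s} B_{⌊n/p⌋} − B_n B_{⌊n/p⌋+mp^{s−1}}`.
[cite: MellitVlasenko2016, §1 (example) with Thm. 1 / (dig2); SamolVanstraten2015, Thm. 6] -/
theorem apery2Number_dwork_congruence {p : ℕ} (hp : p.Prime) {s : ℕ} (hs : 1 ≤ s) (n m : ℕ) :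
    (p : ℤ) ^ s ∣ (apery2Number (n + m * p ^ s) : ℤ) * apery2Number (n / p) -
      (apery2Number n : ℤ) * apery2Number (n / p + m * p ^ (s - 1)) := by
  have hR : ∀ a : ℤ, (p : ℤ) ∣ a ^ p - a := fun a => by
    haveI := Fact.mk hp
    rw [← ZMod.intCast_zmod_eq_zero_iff_dvd]
    push_cast
    rw [ZMod.pow_card, sub_self]
  have h := dwork_congruence hp hR mvLaurent originUnique_mvLaurent hs n m
  simpa only [ctPow_mvLaurent] using h

end Literature.Combinatorics.Enumerative.AperyDworkCongruences
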